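import Literature.Analysis.FluidPDE.PassiveScalarProofs
import Literature.Analysis.FluidPDE.PassiveScalarForced

/-!
# Negative knowledge for the crux `ScalarAnomalySteadySourceFormal` (stmt-AnomalousDissipation-0448), V-a:
# the forced-class toolkit and LINEARITY

Certified copy of the §6 toolkit of the cdisprove work file `Cruxes/ScalarAnomalySteadySourceFormal/Disproof.lean`
for the crux's weak class `Torus.IsWeakScalarTransportForcedOn` (every dimension `d`): `forced_*` —
measurability, `L^∞L²` slices in `L²`, integrability, the weak identity in product form (forced twins of
the `IsWeakScalarTransportOn` API); `forced_sub` — the difference of two forced solutions with the same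
velocity, diffusivity and source is a homogeneous weak solution with the difference of the (integrable)
data.  Supports stmt-AnomalousDissipation-0448.
-/

set_option linter.dupNamespace false

noncomputable section

open scoped BigOperators Topology ENNReal NNReal InnerProductSpace ContDiff
open Filter Set Function MeasureTheory UnitAddTorus Complex

namespace Summit.AnomalousDissipation.AnomalousDissipation.Theorems.ScalarAnomalySteadySourceFormal.Negative

open Literature.Analysis
open Literature.Analysis.FunctionSpaces Literature.Analysis.FunctionSpaces.Torus
open Literature.Analysis.FluidPDE Literature.Analysis.FluidPDE.Torus

section ForcedToolkit


variable {d : Type*} [Fintype d]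

variable {T κ : ℝ} {u : ℝ → UnitAddTorus d → EuclideanSpace ℝ d} {s : ℝ → UnitAddTorus d → ℝ}
  {θ₀ θ₀' : UnitAddTorus d → ℝ} {θ θ' ψ : ℝ → UnitAddTorus d → ℝ}

/-! ### The forced solution class: measurability and integrability (forced twins of the
`IsWeakScalarTransportOn` API of `PassiveScalarProofs`) -/

/-- Joint measurability of `θ` on `(0,T) × T^d` (forced class). [folklore] -/
theorem forced_aestronglyMeasurable_uncurry (h : IsWeakScalarTransportForcedOn T κ u s θ₀ θ) :
    AEStronglyMeasurable (uncurry θ) (((volume : Measure ℝ).restrict (Ioo 0 T)).prod volume) := by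
  rw [← volume_restrict_prod_eq]
  exact FunctionSpaces.Torus.aestronglyMeasurable_uncurry_of_stLift_restrict h.aestronglyMeasurable

/-- Joint measurability of `u` on `(0,T) × T^d` (forced class). [folklore] -/
theorem forced_aestronglyMeasurable_uncurry_velocity (h : IsWeakScalarTransportForcedOn T κ u s θ₀ θ) :
    AEStronglyMeasurable (uncurry u) (((volume : Measure ℝ).restrict (Ioo 0 T)).prod volume) := by
  rw [← volume_restrict_prod_eq]
  exact FunctionSpaces.Torus.aestronglyMeasurable_uncurry_of_stLift_restrict h.aestronglyMeasurable_velocity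

/-- The time slices `θ t` are a.e.-strongly measurable for a.e. `t ∈ (0,T)` (forced class). [folklore] -/
theorem forced_ae_aestronglyMeasurable_slice (h : IsWeakScalarTransportForcedOn T κ u s θ₀ θ) :
    ∀ᵐ t ∂(volume.restrict (Ioo 0 T)), AEStronglyMeasurable (θ t) volume :=
  (forced_aestronglyMeasurable_uncurry h).prodMk_left

/-- The `L^∞_t L²_x` bound in `eLpNorm` form (forced class). [folklore] -/
theorem forced_exists_eLpNorm_le (h : IsWeakScalarTransportForcedOn T κ u s θ₀ θ) :
    ∃ C : ℝ≥0, ∀ᵐ t ∂(volume.restrict (Ioo 0 T)), eLpNorm (θ t) 2 volume ≤ C := by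
  obtain ⟨C, hC⟩ := h.ae_lintegral_sq_le
  refine ⟨NNReal.sqrt C, ?_⟩
  filter_upwards [hC] with t ht
  rw [eLpNorm_eq_lintegral_rpow_enorm_toReal two_ne_zero ENNReal.ofNat_ne_top, ENNReal.toReal_ofNat]
  have h2 : ∫⁻ x, ‖θ t x‖ₑ ^ (2 : ℝ) = ∫⁻ x, ‖θ t x‖ₑ ^ 2 := by
    refine lintegral_congr fun x => ?_
    rw [← ENNReal.rpow_two]
  rw [h2]
  calc (∫⁻ x, ‖θ t x‖ₑ ^ 2) ^ (1 / (2 : ℝ)) ≤ (C : ℝ≥0∞) ^ (1 / (2 : ℝ)) := by gcongr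
    _ = NNReal.sqrt C := by
        rw [← ENNReal.coe_rpow_of_nonneg _ (by norm_num), ← NNReal.sqrt_eq_rpow]

/-- For a.e. `t ∈ (0,T)`, `θ t ∈ L²(T^d)` (forced class). [folklore] -/
theorem forced_ae_memLp_two (h : IsWeakScalarTransportForcedOn T κ u s θ₀ θ) :
    ∀ᵐ t ∂(volume.restrict (Ioo 0 T)), MemLp (θ t) 2 volume := by
  obtain ⟨C, hC⟩ := forced_exists_eLpNorm_le h
  filter_upwards [hC, forced_ae_aestronglyMeasurable_slice h] with t ht hm
  exact ⟨hm, ht.trans_lt ENNReal.coe_lt_top⟩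

/-- `θ` is integrable on `(0,T) × T^d` (forced class). [folklore] -/
theorem forced_integrable_uncurry (h : IsWeakScalarTransportForcedOn T κ u s θ₀ θ) :
    Integrable (uncurry θ) (((volume : Measure ℝ).restrict (Ioo 0 T)).prod volume) := by
  obtain ⟨C, hC⟩ := forced_exists_eLpNorm_le h
  refine ⟨forced_aestronglyMeasurable_uncurry h, ?_⟩
  rw [hasFiniteIntegral_iff_enorm, lintegral_prod _ (forced_aestronglyMeasurable_uncurry h).enorm]
  calc ∫⁻ t in Ioo 0 T, ∫⁻ x, ‖uncurry θ (t, x)‖ₑ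
      ≤ ∫⁻ _ in Ioo 0 T, (C : ℝ≥0∞) := by
        refine lintegral_mono_ae ?_
        filter_upwards [hC, forced_ae_aestronglyMeasurable_slice h] with t ht hm
        calc ∫⁻ x, ‖uncurry θ (t, x)‖ₑ = eLpNorm (θ t) 1 volume := by
              rw [eLpNorm_one_eq_lintegral_enorm]; rfl
          _ ≤ eLpNorm (θ t) 2 volume :=
              eLpNorm_le_eLpNorm_of_exponent_le (by norm_num) hm
          _ ≤ C := ht
    _ < ⊤ := by
        rw [setLIntegral_const]
        exact ENNReal.mul_lt_top ENNReal.coe_lt_top measure_Ioo_lt_top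

/-- `‖u‖ θ` is integrable on `(0,T) × T^d` (forced class). [folklore] -/
theorem forced_integrable_norm_velocity_mul (h : IsWeakScalarTransportForcedOn T κ u s θ₀ θ) :
    Integrable (fun p : ℝ × UnitAddTorus d => ‖u p.1 p.2‖ * θ p.1 p.2)
      (((volume : Measure ℝ).restrict (Ioo 0 T)).prod volume) := by
  have hm : AEStronglyMeasurable (fun p : ℝ × UnitAddTorus d => ‖u p.1 p.2‖ * θ p.1 p.2)
      (((volume : Measure ℝ).restrict (Ioo 0 T)).prod volume) :=
    (forced_aestronglyMeasurable_uncurry_velocity h).norm.mul (forced_aestronglyMeasurable_uncurry h)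
  refine ⟨hm, ?_⟩
  rw [hasFiniteIntegral_iff_enorm, lintegral_prod _ hm.enorm]
  have h' := h.lintegral_mul_lt_top
  simp only [enorm_mul, enorm_norm] at h' ⊢
  exact h'

/-- **Integrability of the weak integrand** `θ (∂ₜψ + u·∇ψ + κΔψ)` on `(0,T) × T^d` (forced
class). [folklore] -/
theorem forced_integrable_weakIntegrand (h : IsWeakScalarTransportForcedOn T κ u s θ₀ θ)
    (hψ : FunctionSpaces.Torus.IsSpaceTimeTest T ψ) :
    Integrable (fun p : ℝ × UnitAddTorus d => θ p.1 p.2 *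
      (FunctionSpaces.Torus.timeDeriv ψ p.1 p.2 + ⟪u p.1 p.2, FunctionSpaces.Torus.gradient (ψ p.1) p.2⟫_ℝ +
        κ * FunctionSpaces.Torus.laplacian (ψ p.1) p.2))
      (((volume : Measure ℝ).restrict (Ioo 0 T)).prod volume) := by
  obtain ⟨C₁, hC₁⟩ := exists_bound_of_continuous_uncurry hψ.continuous_uncurry_timeDeriv 0 T
  obtain ⟨C₂, hC₂⟩ := exists_bound_of_continuous_uncurry hψ.continuous_uncurry_gradient 0 T
  obtain ⟨C₃, hC₃⟩ := exists_bound_of_continuous_uncurry hψ.continuous_uncurry_laplacian 0 T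
  have hmθ := forced_aestronglyMeasurable_uncurry h
  have hmu := forced_aestronglyMeasurable_uncurry_velocity h
  have hm : AEStronglyMeasurable (fun p : ℝ × UnitAddTorus d => θ p.1 p.2 *
      (FunctionSpaces.Torus.timeDeriv ψ p.1 p.2 + ⟪u p.1 p.2, FunctionSpaces.Torus.gradient (ψ p.1) p.2⟫_ℝ +
        κ * FunctionSpaces.Torus.laplacian (ψ p.1) p.2))
      (((volume : Measure ℝ).restrict (Ioo 0 T)).prod volume) := by
    refine hmθ.mul ((?_ : AEStronglyMeasurable _ _).add ?_ |>.add ?_)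
    · exact hψ.continuous_uncurry_timeDeriv.aestronglyMeasurable
    · exact hmu.inner hψ.continuous_uncurry_gradient.aestronglyMeasurable
    · exact (continuous_const.mul hψ.continuous_uncurry_laplacian).aestronglyMeasurable
  have hae : ∀ᵐ p : ℝ × UnitAddTorus d ∂(((volume : Measure ℝ).restrict (Ioo 0 T)).prod volume),
      p.1 ∈ Ioo 0 T :=
    (Measure.quasiMeasurePreserving_fst (μ := (volume : Measure ℝ).restrict (Ioo 0 T))
      (ν := (volume : Measure (UnitAddTorus d)))).ae (ae_restrict_mem measurableSet_Ioo)
  refine Integrable.mono' (g := fun p : ℝ × UnitAddTorus d =>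
      C₁ * ‖uncurry θ p‖ + C₂ * ‖‖u p.1 p.2‖ * θ p.1 p.2‖ + |κ| * C₃ * ‖uncurry θ p‖)
    ((((forced_integrable_uncurry h).norm.const_mul C₁).add
      ((forced_integrable_norm_velocity_mul h).norm.const_mul C₂)).add
      ((forced_integrable_uncurry h).norm.const_mul (|κ| * C₃))) hm ?_
  filter_upwards [hae] with p hp
  have hp' : p.1 ∈ Icc 0 T := Ioo_subset_Icc_self hp
  simp only [uncurry, Real.norm_eq_abs, abs_mul, abs_norm]
  have h1 : |FunctionSpaces.Torus.timeDeriv ψ p.1 p.2| ≤ C₁ := by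
    simpa [Real.norm_eq_abs] using hC₁ p.1 hp' p.2
  have h2 : |⟪u p.1 p.2, FunctionSpaces.Torus.gradient (ψ p.1) p.2⟫_ℝ| ≤ ‖u p.1 p.2‖ * C₂ :=
    (abs_real_inner_le_norm _ _).trans (mul_le_mul_of_nonneg_left (hC₂ p.1 hp' p.2) (norm_nonneg _))
  have h3 : |κ * FunctionSpaces.Torus.laplacian (ψ p.1) p.2| ≤ |κ| * C₃ := by
    rw [abs_mul]
    exact mul_le_mul_of_nonneg_left (by simpa [Real.norm_eq_abs] using hC₃ p.1 hp' p.2) (abs_nonneg _)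
  have hθ0 : 0 ≤ |θ p.1 p.2| := abs_nonneg _
  calc |θ p.1 p.2| * |FunctionSpaces.Torus.timeDeriv ψ p.1 p.2 +
        ⟪u p.1 p.2, FunctionSpaces.Torus.gradient (ψ p.1) p.2⟫_ℝ + κ * FunctionSpaces.Torus.laplacian (ψ p.1) p.2|
      ≤ |θ p.1 p.2| * (C₁ + ‖u p.1 p.2‖ * C₂ + |κ| * C₃) := by
        refine mul_le_mul_of_nonneg_left ((abs_add_le _ _).trans (add_le_add ((abs_add_le _ _).trans
          (add_le_add h1 h2)) h3)) hθ0
    _ = C₁ * |θ p.1 p.2| + C₂ * (‖u p.1 p.2‖ * |θ p.1 p.2|) + |κ| * C₃ * |θ p.1 p.2| := by ring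

/-- The forced weak identity in product-measure form:
`∫_{(0,T)×T^d} θ (∂ₜψ + u·∇ψ + κΔψ) + ∫₀ᵀ∫ s ψ + ∫ θ₀ ψ(0) = 0`. [folklore] -/
theorem forced_integral_prod_weak_eq (h : IsWeakScalarTransportForcedOn T κ u s θ₀ θ)
    (hψ : FunctionSpaces.Torus.IsSpaceTimeTest T ψ) :
    (∫ p : ℝ × UnitAddTorus d, θ p.1 p.2 *
      (FunctionSpaces.Torus.timeDeriv ψ p.1 p.2 + ⟪u p.1 p.2, FunctionSpaces.Torus.gradient (ψ p.1) p.2⟫_ℝ +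
        κ * FunctionSpaces.Torus.laplacian (ψ p.1) p.2)
      ∂(((volume : Measure ℝ).restrict (Ioo 0 T)).prod volume)) +
      (∫ t in Ioo 0 T, ∫ x, s t x * ψ t x) + ∫ x, θ₀ x * ψ 0 x = 0 := by
  rw [integral_prod _ (forced_integrable_weakIntegrand h hψ)]
  exact h.weak_eq ψ hψ

/-- `‖a - b‖ₑ² ≤ 2‖a‖ₑ² + 2‖b‖ₑ²` for reals, in `ℝ≥0∞`. [folklore] -/
theorem enorm_sub_sq_le (a b : ℝ) : ‖a - b‖ₑ ^ 2 ≤ 2 * ‖a‖ₑ ^ 2 + 2 * ‖b‖ₑ ^ 2 := by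
  have e : ∀ r : ℝ, ‖r‖ₑ ^ 2 = ENNReal.ofReal (r ^ 2) := fun r => by
    rw [Real.enorm_eq_ofReal_abs, ← ENNReal.ofReal_pow (abs_nonneg _), sq_abs]
  rw [e, e, e, ← ENNReal.ofReal_ofNat 2, ← ENNReal.ofReal_mul (by norm_num),
    ← ENNReal.ofReal_mul (by norm_num), ← ENNReal.ofReal_add (by positivity) (by positivity)]
  exact ENNReal.ofReal_le_ofReal (by nlinarith [sq_nonneg (a + b)])

/-- **LINEARITY.** The difference of two weak solutions of the FORCED equation with the same
velocity, diffusivity and source, and integrable data, is a weak solution of the HOMOGENEOUS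
equation with the difference of the data (all clauses of the class are (sub)linear; the source
pairings cancel). [folklore] -/
theorem forced_sub (h : IsWeakScalarTransportForcedOn T κ u s θ₀ θ)
    (h' : IsWeakScalarTransportForcedOn T κ u s θ₀' θ') (hθ₀ : Integrable θ₀ volume)
    (hθ₀' : Integrable θ₀' volume) :
    IsWeakScalarTransportOn T κ u (fun x => θ₀ x - θ₀' x) (fun t x => θ t x - θ' t x) := by
  obtain ⟨C, hC⟩ := h.ae_lintegral_sq_le
  obtain ⟨C', hC'⟩ := h'.ae_lintegral_sq_le
  refine ⟨?_, h.aestronglyMeasurable_velocity, ?_, h.lintegral_velocity_lt_top, ?_,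
    h.ae_isWeaklyDivFree, ?_⟩
  -- measurability of the difference (through the lift)
  · exact h.aestronglyMeasurable.sub h'.aestronglyMeasurable
  -- `L^∞_t L²_x`
  · refine ⟨2 * C + 2 * C', ?_⟩
    filter_upwards [hC, hC', forced_ae_aestronglyMeasurable_slice h,
      forced_ae_aestronglyMeasurable_slice h'] with t ht ht' hm hm'
    calc ∫⁻ x, ‖θ t x - θ' t x‖ₑ ^ 2
        ≤ ∫⁻ x, (2 * ‖θ t x‖ₑ ^ 2 + 2 * ‖θ' t x‖ₑ ^ 2) := lintegral_mono fun x => enorm_sub_sq_le _ _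
      _ = (2 * ∫⁻ x, ‖θ t x‖ₑ ^ 2) + 2 * ∫⁻ x, ‖θ' t x‖ₑ ^ 2 := by
          rw [lintegral_add_left' ((hm.enorm.pow_const 2).const_mul _), lintegral_const_mul' _ _ (by simp),
            lintegral_const_mul' _ _ (by simp)]
      _ ≤ (2 * (C : ℝ≥0∞)) + 2 * (C' : ℝ≥0∞) := by gcongr
      _ = ((2 * C + 2 * C' : ℝ≥0) : ℝ≥0∞) := by push_cast; ring
  -- `u (θ - θ') ∈ L¹`
  · have hprod : Integrable (fun p : ℝ × UnitAddTorus d => ‖u p.1 p.2‖ * (θ p.1 p.2 - θ' p.1 p.2))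
        (((volume : Measure ℝ).restrict (Ioo 0 T)).prod volume) :=
      ((forced_integrable_norm_velocity_mul h).sub (forced_integrable_norm_velocity_mul h')).congr
        (Eventually.of_forall fun p => by simp only [Pi.sub_apply]; ring)
    have hfin := hprod.hasFiniteIntegral
    rw [hasFiniteIntegral_iff_enorm, lintegral_prod _ hprod.aestronglyMeasurable.enorm] at hfin
    refine lt_of_le_of_lt (lintegral_mono fun t => lintegral_mono fun x => ?_) hfin
    rw [← enorm_norm (u t x), ← enorm_mul]
  -- the weak identity
  · intro ψ hψ
    have e := forced_integral_prod_weak_eq h hψ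
    have e' := forced_integral_prod_weak_eq h' hψ
    have hI := forced_integrable_weakIntegrand h hψ
    have hI' := forced_integrable_weakIntegrand h' hψ
    have hψ0 : Continuous (ψ 0) := (hψ.isSmooth_slice 0).continuous
    obtain ⟨K, hK⟩ := FunctionSpaces.Torus.exists_forall_norm_le_of_continuous hψ0
    have hd : Integrable (fun x => θ₀ x * ψ 0 x) volume :=
      hθ₀.mul_bdd (c := K) hψ0.aestronglyMeasurable (Eventually.of_forall hK)
    have hd' : Integrable (fun x => θ₀' x * ψ 0 x) volume :=
      hθ₀'.mul_bdd (c := K) hψ0.aestronglyMeasurable (Eventually.of_forall hK)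
    have hsub : (∫ t in Ioo 0 T, ∫ x, (θ t x - θ' t x) *
        (FunctionSpaces.Torus.timeDeriv ψ t x + ⟪u t x, FunctionSpaces.Torus.gradient (ψ t) x⟫_ℝ +
          κ * FunctionSpaces.Torus.laplacian (ψ t) x)) =
        (∫ p : ℝ × UnitAddTorus d, θ p.1 p.2 *
          (FunctionSpaces.Torus.timeDeriv ψ p.1 p.2 + ⟪u p.1 p.2, FunctionSpaces.Torus.gradient (ψ p.1) p.2⟫_ℝ +
            κ * FunctionSpaces.Torus.laplacian (ψ p.1) p.2)
          ∂(((volume : Measure ℝ).restrict (Ioo 0 T)).prod volume)) -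
        ∫ p : ℝ × UnitAddTorus d, θ' p.1 p.2 *
          (FunctionSpaces.Torus.timeDeriv ψ p.1 p.2 + ⟪u p.1 p.2, FunctionSpaces.Torus.gradient (ψ p.1) p.2⟫_ℝ +
            κ * FunctionSpaces.Torus.laplacian (ψ p.1) p.2)
          ∂(((volume : Measure ℝ).restrict (Ioo 0 T)).prod volume) := by
      have hF : Integrable (fun p : ℝ × UnitAddTorus d => θ p.1 p.2 *
          (FunctionSpaces.Torus.timeDeriv ψ p.1 p.2 + ⟪u p.1 p.2, FunctionSpaces.Torus.gradient (ψ p.1) p.2⟫_ℝ +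
            κ * FunctionSpaces.Torus.laplacian (ψ p.1) p.2) - θ' p.1 p.2 *
          (FunctionSpaces.Torus.timeDeriv ψ p.1 p.2 + ⟪u p.1 p.2, FunctionSpaces.Torus.gradient (ψ p.1) p.2⟫_ℝ +
            κ * FunctionSpaces.Torus.laplacian (ψ p.1) p.2))
          (((volume : Measure ℝ).restrict (Ioo 0 T)).prod volume) := hI.sub hI'
      rw [← integral_sub hI hI', integral_prod _ hF]
      refine integral_congr_ae (Eventually.of_forall fun t => ?_)
      refine integral_congr_ae (Eventually.of_forall fun x => ?_)
      simp only
      ring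
    rw [hsub]
    simp_rw [sub_mul]
    rw [integral_sub hd hd']
    linarith




end ForcedToolkit

end Summit.AnomalousDissipation.AnomalousDissipation.Theorems.ScalarAnomalySteadySourceFormal.Negative
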